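import Summits.Ventures.Crystal3D.Theorems.StickyWulffConstantTextureLiminfTexShadowLevelReachHexagonPooled
import Summits.Ventures.Crystal3D.Theorems.StickyWulffConstantCoaxialWallLawOneFccCoreCounts
import Summits.Ventures.Crystal3D.Theorems.StickyWulffConstantCoaxialWallLawBarlowOneFccPayerWindow
import HarnessLib

/-!
# Both plates pooled under one row: the FLUX form and lane T's PAYER CURRENCY (O(ρ) rims, the extra bands paid)
# (lane T, crux `TextureLiminfV5`, stmt-Ventures-23912, registered stub `stub_terraceCensus`; (β) plates side — HOME/wall-p1-g22/BETA-CUT-g22.md §3/§5)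

HONEST FRAMING. Venture `Summits/Ventures/Crystal3D` (cell `crystal3d-full`), route `route-Ventures-StickyWulffConstant`, helper `--supports` the law-v5
crux `TextureLiminfV5` (stmt-Ventures-23912), lane T.  Census-free and certificate-free (the local row `LocalEndRowA ver sF ⟨Fr, RT↑⟩ ⟨G₂, RT↓⟩` is a
HYPOTHESIS BY NAME, any `sF`); `KissingGap δ` / `KissingClassification δ` by name.  Nothing about energies; F-C1 not moved.

* **`hexagon_twoPlate_flux_le_payers_cuts`** — `hexagon_twoPlate_sources_le_payers_cuts` (…LevelReachHexagonPooled) with both source sums replaced by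
  lane F's lattice-line flux `oneFcc_srcA_ge` (…OneFccFluxF): the bottom plate directly (`Fr r = L₁ r` on basal `r`), the top plate in the mirrored cell
  and transported (tilt `−ν₂`, phase `(L₂⁻¹s₂)₂ − hν₂`, slice height `h+(R₀+1)+1`, rises `−(G₂ r)₂`), for ANY finite layer sets `Kw₁`, `Kw₂`:
  `flux₁(Kw₁) + flux₂(Kw₂) ≤ sF·Σ_PAYW (12 − deg) + ΣCUT₁ + ΣCUT₂ + #RT₁·rims₁ + #RT₂·rims₂`.
* **`hexagon_twoPlate_flux_le_payerSum`** — the same in lane T's payer currency `PAY = {y ∈ X : deg y ≠ 12, −R₀−2 ≤ y₂ ≤ h+R₀+2}` with every rim and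
  extra-band term bounded by shell counts (lane F's `extraPayers_card_le₁/₂`, `card_mul_le_of_separated_in_shell`, `#RT ≤ 12`):
  `flux₁ + flux₂ ≤ sF·Σ_PAY (12 − deg) + ΣCUT₁ + ΣCUT₂ + (3456·sF + 1710720)·ρ` (`sF ≥ 0`, the cell cylinder `hcell`).
This is the (β) plates side in the shape the origins-based assembly consumes: «joint hexagon flux·A − located cuts − O(ρ) ≤ sF · (ONE payer sum)».
WHAT THIS IS NOT: the row, the CUT bounds, the born-line supply, the flux-to-area evaluation, the certificate; F-C1 not moved.
-/

noncomputable section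

namespace Summit.Ventures.Crystal3D.Theorems

open Summit.Ventures.Crystal3D Finset
open Literature.MathematicalPhysics.StatisticalMechanics (barlowPos barlowStacking IsHaggSeq barlowPos_mem basalMirror
  basalMirror_apply_coord basalMirror_basalMirror)
open Summit.Ventures.Crystal3D.Cruxes.TextureLiminf.TexShadow (E3 stacking)
open scoped InnerProductSpace

open scoped Classical in
/-- **The TOP plate's flux bound in the original coordinates**: lane F's `oneFcc_srcA_ge` in the mirrored cell, transported. -/
theorem topPlate_flux_le_sources {σ₂ : ℤ → ℤ} (L₂ : E3 ≃ₗᵢ[ℝ] E3) (s₂ : E3)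
    (G₂ : E3 ≃ₗᵢ[ℝ] E3) {t' : ℤ} (hG₂ : (t' = 1 ∧ G₂ = L₂) ∨ (t' = -1 ∧ G₂ = basalMirror.trans L₂))
    (P₂ : Finset E3) (R₀ h ρ : ℝ) (hR₀ : 3 ≤ R₀) (hh : 0 ≤ h) (hρ : 4 ≤ ρ)
    (hP₂ : ∀ p, p ∈ P₂ ↔ (p ∈ stacking L₂ s₂ σ₂ ∧ h + R₀ ≤ p 2 ∧ p 2 ≤ h + 2 * R₀ ∧ p 0 ^ 2 + p 1 ^ 2 ≤ ρ ^ 2))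
    (Kw : Finset ℤ) :
    ∑ k ∈ Kw, (if ¬ (σ₂ (k - 1) = -t' ∧ σ₂ k = -t') then (1 : ℝ) else 0) *
        (4 * (∑ r ∈ inPlaneRoots G₂ (-1), -(G₂ r) 2) / (Real.sqrt 3 * (1 - (L₂.symm (EuclideanSpace.single (2 : Fin 3) (1 : ℝ))) 2 ^ 2)) *
          Real.sqrt (max 0 ((ρ - 4) ^ 2 * (1 - (L₂.symm (EuclideanSpace.single (2 : Fin 3) (1 : ℝ))) 2 ^ 2) -
            ((k : ℝ) * Real.sqrt (2 / 3) + (L₂.symm s₂) 2 -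
              (h + (R₀ + 1) + 1) * (L₂.symm (EuclideanSpace.single (2 : Fin 3) (1 : ℝ))) 2) ^ 2)) -
          ((inPlaneRoots G₂ (-1)).card : ℝ)) ≤
      ((∑ r ∈ inPlaneRoots G₂ (-1),
        ((P₂.filter fun p => h + (R₀ + 1) + 1 ≤ p 2 ∧ p 2 ≤ h + (R₀ + 1) + 1 + 1 ∧ p 0 ^ 2 + p 1 ^ 2 ≤ (ρ - 1 - 1) ^ 2).filter
          fun p => (∃ k i j : ℤ, p = L₂ (barlowPos 1 (Real.sqrt (2 / 3)) σ₂ k i j) + s₂ ∧ ¬ (σ₂ (k - 1) = -t' ∧ σ₂ k = -t')) ∧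
            -(R₀ + 1) - 1 < (p + G₂ r) 2 ∧ (p + G₂ r) 2 < h + (R₀ + 1) + 1).card : ℕ) : ℝ) := by
  set Fr' : E3 ≃ₗᵢ[ℝ] E3 := G₂.trans basalMirror with hFr'
  have hFr'cases : (t' = 1 ∧ Fr' = L₂.trans basalMirror) ∨ (t' = -1 ∧ Fr' = basalMirror.trans (L₂.trans basalMirror)) := by
    rcases hG₂ with ⟨ht, hG⟩ | ⟨ht, hG⟩
    · exact Or.inl ⟨ht, by rw [hFr', hG]⟩
    · exact Or.inr ⟨ht, by rw [hFr', hG]; exact LinearIsometryEquiv.ext fun x => rfl⟩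
  have hP₁' := mirrorCell_plate_bottom P₂ L₂ s₂ σ₂ R₀ h ρ hP₂
  have h0 := oneFcc_srcA_ge (L₂.trans basalMirror) (basalMirror s₂ + h • EuclideanSpace.single (2 : Fin 3) (1 : ℝ)) Fr'
    (fun r hr => frame_apply_basal hFr'cases hr) t'
    (P₂.image (fun q => basalMirror q + h • EuclideanSpace.single (2 : Fin 3) (1 : ℝ))) R₀ h ρ hR₀ hh hρ hP₁' Kw
  have hRT : inPlaneRoots Fr' 1 = inPlaneRoots G₂ (-1) := inPlaneRoots_trans_basalMirror G₂
  rw [hRT, sum_congr rfl fun r _ => card_topSources_mirror P₂ L₂ G₂ s₂ σ₂ t' R₀ h ρ r] at h0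
  have hrise : ∑ r ∈ inPlaneRoots G₂ (-1), (Fr' r) 2 = ∑ r ∈ inPlaneRoots G₂ (-1), -(G₂ r) 2 :=
    sum_congr rfl fun r _ => trans_basalMirror_apply_two G₂ r
  rw [hrise, symm_e₃_two_trans_basalMirror, symm_two_trans_basalMirror_shift, neg_sq] at h0
  have harg : ∀ k : ℤ, (k : ℝ) * Real.sqrt (2 / 3) + ((L₂.symm s₂) 2 - h * (L₂.symm (EuclideanSpace.single (2 : Fin 3) (1 : ℝ))) 2) -
      (-(R₀ + 1) - 1) * -(L₂.symm (EuclideanSpace.single (2 : Fin 3) (1 : ℝ))) 2 =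
      (k : ℝ) * Real.sqrt (2 / 3) + (L₂.symm s₂) 2 - (h + (R₀ + 1) + 1) * (L₂.symm (EuclideanSpace.single (2 : Fin 3) (1 : ℝ))) 2 :=
    fun k => by ring
  simp only [harg] at h0
  exact h0

open scoped Classical in
/-- **Both plates' hexagon FLUX under ONE local row.**  See the module docstring. -/
theorem hexagon_twoPlate_flux_le_payers_cuts (ver : WordVersion) {δ : ℝ} (hg : KissingGap δ) (hc : KissingClassification δ)
    {σ₁ σ₂ : ℤ → ℤ} (hσ₁ : IsHaggSeq σ₁) (hσ₂ : IsHaggSeq σ₂) (L₁ L₂ : E3 ≃ₗᵢ[ℝ] E3) (s₁ s₂ : E3)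
    (Fr : E3 ≃ₗᵢ[ℝ] E3) {t : ℤ} (hFr : (t = 1 ∧ Fr = L₁) ∨ (t = -1 ∧ Fr = basalMirror.trans L₁))
    (G₂ : E3 ≃ₗᵢ[ℝ] E3) {t' : ℤ} (hG₂ : (t' = 1 ∧ G₂ = L₂) ∨ (t' = -1 ∧ G₂ = basalMirror.trans L₂))
    (hne₁ : (Fr : E3 → E3) '' ↑fccSlots ≠ (L₂ : E3 → E3) '' ↑fccSlots)
    (hne₂ : (Fr : E3 → E3) '' ↑fccSlots ≠ ((basalMirror.trans L₂ : E3 ≃ₗᵢ[ℝ] E3) : E3 → E3) '' ↑fccSlots)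
    (hne₁' : (G₂ : E3 → E3) '' ↑fccSlots ≠ (L₁ : E3 → E3) '' ↑fccSlots)
    (hne₂' : (G₂ : E3 → E3) '' ↑fccSlots ≠ ((basalMirror.trans L₁ : E3 ≃ₗᵢ[ℝ] E3) : E3 → E3) '' ↑fccSlots)
    {sF : ℝ} (hrow : LocalEndRowA ver sF ⟨Fr, inPlaneRoots Fr 1⟩ ⟨G₂, inPlaneRoots G₂ (-1)⟩)
    (X P₁ P₂ : Finset E3) (R₀ h ρ : ℝ) (hR₀ : 5 ≤ R₀) (hh : 0 ≤ h) (hρ : R₀ + 2 ≤ ρ)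
    (hX : ∀ p ∈ X, ∀ q ∈ X, p ≠ q → 1 ≤ dist p q) (hP₁X : P₁ ⊆ X) (hP₂X : P₂ ⊆ X)
    (hP₁ : ∀ p, p ∈ P₁ ↔ (p ∈ stacking L₁ s₁ σ₁ ∧ -(2 * R₀) ≤ p 2 ∧ p 2 ≤ -R₀ ∧ p 0 ^ 2 + p 1 ^ 2 ≤ ρ ^ 2))
    (hP₂ : ∀ p, p ∈ P₂ ↔ (p ∈ stacking L₂ s₂ σ₂ ∧ h + R₀ ≤ p 2 ∧ p 2 ≤ h + 2 * R₀ ∧ p 0 ^ 2 + p 1 ^ 2 ≤ ρ ^ 2))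
    (Kw₁ Kw₂ : Finset ℤ) :
    ∑ k ∈ Kw₁, (if ¬ (σ₁ (k - 1) = -t ∧ σ₁ k = -t) then (1 : ℝ) else 0) *
        (4 * (∑ r ∈ inPlaneRoots Fr 1, (Fr r) 2) / (Real.sqrt 3 * (1 - (L₁.symm (EuclideanSpace.single (2 : Fin 3) (1 : ℝ))) 2 ^ 2)) *
          Real.sqrt (max 0 ((ρ - 4) ^ 2 * (1 - (L₁.symm (EuclideanSpace.single (2 : Fin 3) (1 : ℝ))) 2 ^ 2) -
            ((k : ℝ) * Real.sqrt (2 / 3) + (L₁.symm s₁) 2 -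
              (-(R₀ + 1) - 1) * (L₁.symm (EuclideanSpace.single (2 : Fin 3) (1 : ℝ))) 2) ^ 2)) -
          ((inPlaneRoots Fr 1).card : ℝ)) +
      ∑ k ∈ Kw₂, (if ¬ (σ₂ (k - 1) = -t' ∧ σ₂ k = -t') then (1 : ℝ) else 0) *
        (4 * (∑ r ∈ inPlaneRoots G₂ (-1), -(G₂ r) 2) / (Real.sqrt 3 * (1 - (L₂.symm (EuclideanSpace.single (2 : Fin 3) (1 : ℝ))) 2 ^ 2)) *
          Real.sqrt (max 0 ((ρ - 4) ^ 2 * (1 - (L₂.symm (EuclideanSpace.single (2 : Fin 3) (1 : ℝ))) 2 ^ 2) -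
            ((k : ℝ) * Real.sqrt (2 / 3) + (L₂.symm s₂) 2 -
              (h + (R₀ + 1) + 1) * (L₂.symm (EuclideanSpace.single (2 : Fin 3) (1 : ℝ))) 2) ^ 2)) -
          ((inPlaneRoots G₂ (-1)).card : ℝ)) ≤
      sF * ∑ z ∈ X.filter (fun z => (X.filter fun q => dist z q = 1).card ≤ 11 ∧
          -(R₀ + 1) - 2 ≤ z 2 ∧ z 2 ≤ h + (R₀ + 1) + 2), ((12 : ℝ) - ((X.filter fun q => dist z q = 1).card : ℝ)) +
        ((∑ r ∈ inPlaneRoots Fr 1, (X.filter fun b => -(R₀ + 1) - 1 ≤ b 2 ∧ b 2 < h + (R₀ + 1) + 1 ∧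
            (∃ μ, ⟪r, μ⟫_ℝ = Real.sqrt (2 / 3) ∧ IsTwinReading X Fr (Fr μ) b) ∧ b - Fr r ∈ X).card : ℕ) : ℝ) +
        ((∑ r ∈ inPlaneRoots G₂ (-1), (X.filter fun b => -(R₀ + 1) - 1 < b 2 ∧ b 2 ≤ h + (R₀ + 1) + 1 ∧
            (∃ μ, ⟪r, μ⟫_ℝ = Real.sqrt (2 / 3) ∧ IsTwinReading X G₂ (G₂ μ) b) ∧ b - G₂ r ∈ X).card : ℕ) : ℝ) +
        ((inPlaneRoots Fr 1).card : ℝ) *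
          (220 * ((X.filter fun s => h + (R₀ + 1) + 1 ≤ s 2 ∧ s 2 ≤ h + (R₀ + 1) + 1 + 1 ∧
              (ρ - 1 - 2) ^ 2 < s 0 ^ 2 + s 1 ^ 2).card : ℝ) +
            220 * ((X.filter fun s => -(R₀ + 1) - 1 - 1 ≤ s 2 ∧ s 2 < -(R₀ + 1) - 1 ∧
              (ρ - 1 - 1) ^ 2 < s 0 ^ 2 + s 1 ^ 2).card : ℝ)) +
        ((inPlaneRoots G₂ (-1)).card : ℝ) *
          (220 * ((X.filter fun s => -(R₀ + 1) - 1 - 1 ≤ s 2 ∧ s 2 ≤ -(R₀ + 1) - 1 ∧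
              (ρ - 1 - 2) ^ 2 < s 0 ^ 2 + s 1 ^ 2).card : ℝ) +
            220 * ((X.filter fun s => h + (R₀ + 1) + 1 < s 2 ∧ s 2 ≤ h + (R₀ + 1) + 1 + 1 ∧
              (ρ - 1 - 1) ^ 2 < s 0 ^ 2 + s 1 ^ 2).card : ℝ)) := by
  have h0₁ := oneFcc_srcA_ge L₁ s₁ Fr (fun r hr => frame_apply_basal hFr hr) t P₁ R₀ h ρ (by linarith) hh (by linarith) hP₁ Kw₁
  have h0₂ := topPlate_flux_le_sources L₂ s₂ G₂ hG₂ P₂ R₀ h ρ (by linarith) hh (by linarith) hP₂ Kw₂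
  have h1 := hexagon_twoPlate_sources_le_payers_cuts ver hg hc hσ₁ hσ₂ L₁ L₂ s₁ s₂ Fr hFr G₂ hG₂ hne₁ hne₂ hne₁' hne₂' hrow X P₁ P₂
    R₀ h ρ hR₀ hρ hX hP₁X hP₂X hP₁ hP₂
  linarith only [h0₁, h0₂, h1]

/-- A `1`-separated set in a height band of thickness `1` and the lateral annulus `(ρ−3, ρ]` has at most `180·ρ` balls. -/
theorem card_band_annulus₃_le (S : Finset E3) (hsep : ∀ p ∈ S, ∀ q ∈ S, p ≠ q → 1 ≤ dist p q) (z₁ ρ : ℝ) (hρ : 4 ≤ ρ)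
    (hmem : ∀ p ∈ S, z₁ ≤ p 2 ∧ p 2 ≤ z₁ + 1 ∧ (ρ - 1 - 2) ^ 2 < p 0 ^ 2 + p 1 ^ 2 ∧ p 0 ^ 2 + p 1 ^ 2 ≤ ρ ^ 2) :
    (S.card : ℝ) ≤ 180 * ρ := by
  have key := card_mul_le_of_separated_in_shell S hsep z₁ (z₁ + 1) (ρ - 1 - 2) ρ (by linarith) (by linarith) (by linarith) hmem
  have e : (z₁ + 1 - z₁ + 2) * (Real.pi * (ρ + 1) ^ 2 - Real.pi * (ρ - 1 - 2 - 1) ^ 2) = (Real.pi / 6) * (180 * ρ - 270) := by ring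
  rw [e] at key
  have hπ : 0 < Real.pi / 6 := by positivity
  have := le_of_mul_le_mul_right (by linarith [key] : (S.card : ℝ) * (Real.pi / 6) ≤ (180 * ρ - 270) * (Real.pi / 6)) hπ
  linarith

/-- A `1`-separated set in a height band of thickness `1` and the lateral annulus `(ρ−2, ρ]` has at most `144·ρ` balls. -/
theorem card_band_annulus₂_le (S : Finset E3) (hsep : ∀ p ∈ S, ∀ q ∈ S, p ≠ q → 1 ≤ dist p q) (z₁ ρ : ℝ) (hρ : 3 ≤ ρ)
    (hmem : ∀ p ∈ S, z₁ ≤ p 2 ∧ p 2 ≤ z₁ + 1 ∧ (ρ - 1 - 1) ^ 2 < p 0 ^ 2 + p 1 ^ 2 ∧ p 0 ^ 2 + p 1 ^ 2 ≤ ρ ^ 2) :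
    (S.card : ℝ) ≤ 144 * ρ := by
  have key := card_mul_le_of_separated_in_shell S hsep z₁ (z₁ + 1) (ρ - 1 - 1) ρ (by linarith) (by linarith) (by linarith) hmem
  have e : (z₁ + 1 - z₁ + 2) * (Real.pi * (ρ + 1) ^ 2 - Real.pi * (ρ - 1 - 1 - 1) ^ 2) = (Real.pi / 6) * (144 * ρ - 144) := by ring
  rw [e] at key
  have hπ : 0 < Real.pi / 6 := by positivity
  have := le_of_mul_le_mul_right (by linarith [key] : (S.card : ℝ) * (Real.pi / 6) ≤ (144 * ρ - 144) * (Real.pi / 6)) hπ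
  linarith

section PayerSum

variable {X P₁ P₂ : Finset E3} {σ₁ σ₂ : ℤ → ℤ} (hσ₁ : IsHaggSeq σ₁) (hσ₂ : IsHaggSeq σ₂) (L₁ L₂ : E3 ≃ₗᵢ[ℝ] E3) (s₁ s₂ : E3)
  {R₀ h ρ : ℝ} (hX : ∀ p ∈ X, ∀ q ∈ X, p ≠ q → 1 ≤ dist p q) (hP₁X : P₁ ⊆ X) (hP₂X : P₂ ⊆ X)
  (hcell : ∀ p ∈ X, -(2 * R₀) ≤ p 2 ∧ p 2 ≤ h + 2 * R₀ ∧ p 0 ^ 2 + p 1 ^ 2 ≤ ρ ^ 2)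
  (hP₁ : ∀ p, p ∈ P₁ ↔ (p ∈ stacking L₁ s₁ σ₁ ∧ -(2 * R₀) ≤ p 2 ∧ p 2 ≤ -R₀ ∧ p 0 ^ 2 + p 1 ^ 2 ≤ ρ ^ 2))
  (hP₂ : ∀ p, p ∈ P₂ ↔ (p ∈ stacking L₂ s₂ σ₂ ∧ h + R₀ ≤ p 2 ∧ p 2 ≤ h + 2 * R₀ ∧ p 0 ^ 2 + p 1 ^ 2 ≤ ρ ^ 2))

include hσ₁ hσ₂ hX hP₁X hP₂X hcell hP₁ hP₂ in
open scoped Classical in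
/-- **The widened-window payer sum in lane T's currency**: the two extra height-1 bands hold only rim balls (`extraPayers_card_le₁/₂`),
each worth `≤ 12`: `Σ_PAYW (12 − deg) ≤ Σ_PAY (12 − deg) + 3456·ρ`. -/
theorem widenedPayerSum_le (hR₀ : 4 ≤ R₀) (hρ : 3 ≤ ρ) :
    ∑ z ∈ X.filter (fun z => (X.filter fun q => dist z q = 1).card ≤ 11 ∧
        -(R₀ + 1) - 2 ≤ z 2 ∧ z 2 ≤ h + (R₀ + 1) + 2), ((12 : ℝ) - ((X.filter fun q => dist z q = 1).card : ℝ)) ≤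
      ∑ y ∈ X.filter (fun y => (X.filter fun q => dist y q = 1).card ≠ 12 ∧ -R₀ - 2 ≤ y 2 ∧ y 2 ≤ h + R₀ + 2),
          ((12 : ℝ) - ((X.filter fun q => dist y q = 1).card : ℝ)) + 3456 * ρ := by
  set deg : E3 → ℕ := fun z => (X.filter fun q => dist z q = 1).card with hdeg
  set f : E3 → ℝ := fun z => (12 : ℝ) - (deg z : ℝ) with hf
  set PAYW := X.filter (fun z => deg z ≤ 11 ∧ -(R₀ + 1) - 2 ≤ z 2 ∧ z 2 ≤ h + (R₀ + 1) + 2) with hPAYW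
  set PAY := X.filter (fun y => deg y ≠ 12 ∧ -R₀ - 2 ≤ y 2 ∧ y 2 ≤ h + R₀ + 2) with hPAY
  set EX₁ := X.filter (fun z => deg z ≤ 11 ∧ -(R₀ + 1) - 2 ≤ z 2 ∧ z 2 < -R₀ - 2) with hEX₁
  set EX₂ := X.filter (fun z => deg z ≤ 11 ∧ h + R₀ + 2 < z 2 ∧ z 2 ≤ h + (R₀ + 1) + 2) with hEX₂
  show ∑ z ∈ PAYW, f z ≤ ∑ y ∈ PAY, f y + 3456 * ρ
  have hdeg12 : ∀ z, deg z ≤ 12 := fun z => card_filter_dist_eq_one_le_twelve X hX z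
  have hf12 : ∀ z, f z ≤ 12 := fun z => by
    have : (0 : ℝ) ≤ (deg z : ℝ) := Nat.cast_nonneg _
    simp only [hf]; linarith
  have hfnn : ∀ z, deg z ≠ 12 → 0 ≤ f z := fun z hz => by
    have h12 : deg z ≤ 11 := by have := hdeg12 z; omega
    have : (deg z : ℝ) ≤ 11 := by exact_mod_cast h12
    simp only [hf]; linarith
  have hsplit := (sum_filter_add_sum_filter_not PAYW (fun z => -R₀ - 2 ≤ z 2 ∧ z 2 ≤ h + R₀ + 2) f).symm
  have hmid : ∑ z ∈ PAYW.filter (fun z => -R₀ - 2 ≤ z 2 ∧ z 2 ≤ h + R₀ + 2), f z ≤ ∑ y ∈ PAY, f y := by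
    refine sum_le_sum_of_subset_of_nonneg (fun z hz => ?_) (fun y hy _ => hfnn y (mem_filter.1 hy).2.1)
    obtain ⟨hzW, h1, h2⟩ := mem_filter.1 hz
    obtain ⟨hzX, hz11, -, -⟩ := mem_filter.1 hzW
    exact mem_filter.2 ⟨hzX, by omega, h1, h2⟩
  have hout : ∑ z ∈ PAYW.filter (fun z => ¬ (-R₀ - 2 ≤ z 2 ∧ z 2 ≤ h + R₀ + 2)), f z ≤ 12 * ((EX₁.card : ℝ) + EX₂.card) := by
    have hsub : PAYW.filter (fun z => ¬ (-R₀ - 2 ≤ z 2 ∧ z 2 ≤ h + R₀ + 2)) ⊆ EX₁ ∪ EX₂ := by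
      intro z hz
      obtain ⟨hzW, hnot⟩ := mem_filter.1 hz
      obtain ⟨hzX, hz11, h1, h2⟩ := mem_filter.1 hzW
      rw [mem_union]
      by_cases hlo : z 2 < -R₀ - 2
      · exact Or.inl (mem_filter.2 ⟨hzX, hz11, h1, hlo⟩)
      · push Not at hlo
        have hhi : h + R₀ + 2 < z 2 := by
          by_contra hle; push Not at hle; exact hnot ⟨hlo, hle⟩
        exact Or.inr (mem_filter.2 ⟨hzX, hz11, hhi, h2⟩)
    calc ∑ z ∈ PAYW.filter (fun z => ¬ (-R₀ - 2 ≤ z 2 ∧ z 2 ≤ h + R₀ + 2)), f z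
        ≤ ∑ z ∈ PAYW.filter (fun z => ¬ (-R₀ - 2 ≤ z 2 ∧ z 2 ≤ h + R₀ + 2)), (12 : ℝ) := sum_le_sum fun z _ => hf12 z
      _ = 12 * ((PAYW.filter (fun z => ¬ (-R₀ - 2 ≤ z 2 ∧ z 2 ≤ h + R₀ + 2))).card : ℝ) := by
          rw [sum_const, nsmul_eq_mul, mul_comm]
      _ ≤ 12 * ((EX₁.card : ℝ) + EX₂.card) := by
          have h1 := card_le_card hsub
          have h2 := card_union_le EX₁ EX₂
          have : ((PAYW.filter (fun z => ¬ (-R₀ - 2 ≤ z 2 ∧ z 2 ≤ h + R₀ + 2))).card : ℝ) ≤ (EX₁.card : ℝ) + EX₂.card := by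
            exact_mod_cast h1.trans h2
          linarith
  have hEX₁ : (EX₁.card : ℝ) ≤ 144 * ρ := extraPayers_card_le₁ hσ₁ L₁ s₁ hX hP₁X hcell hP₁ hR₀ hρ
  have hEX₂ : (EX₂.card : ℝ) ≤ 144 * ρ := extraPayers_card_le₂ hσ₂ L₂ s₂ hX hP₂X hcell hP₂ hR₀ hρ
  rw [hsplit]; nlinarith [hmid, hout, hEX₁, hEX₂]

end PayerSum

open scoped Classical in
/-- **Both plates' hexagon flux in lane T's payer currency** (`sF ≥ 0`; the whole configuration in the cell cylinder).  See the module docstring. -/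
theorem hexagon_twoPlate_flux_le_payerSum (ver : WordVersion) {δ : ℝ} (hg : KissingGap δ) (hc : KissingClassification δ)
    {σ₁ σ₂ : ℤ → ℤ} (hσ₁ : IsHaggSeq σ₁) (hσ₂ : IsHaggSeq σ₂) (L₁ L₂ : E3 ≃ₗᵢ[ℝ] E3) (s₁ s₂ : E3)
    (Fr : E3 ≃ₗᵢ[ℝ] E3) {t : ℤ} (hFr : (t = 1 ∧ Fr = L₁) ∨ (t = -1 ∧ Fr = basalMirror.trans L₁))
    (G₂ : E3 ≃ₗᵢ[ℝ] E3) {t' : ℤ} (hG₂ : (t' = 1 ∧ G₂ = L₂) ∨ (t' = -1 ∧ G₂ = basalMirror.trans L₂))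
    (hne₁ : (Fr : E3 → E3) '' ↑fccSlots ≠ (L₂ : E3 → E3) '' ↑fccSlots)
    (hne₂ : (Fr : E3 → E3) '' ↑fccSlots ≠ ((basalMirror.trans L₂ : E3 ≃ₗᵢ[ℝ] E3) : E3 → E3) '' ↑fccSlots)
    (hne₁' : (G₂ : E3 → E3) '' ↑fccSlots ≠ (L₁ : E3 → E3) '' ↑fccSlots)
    (hne₂' : (G₂ : E3 → E3) '' ↑fccSlots ≠ ((basalMirror.trans L₁ : E3 ≃ₗᵢ[ℝ] E3) : E3 → E3) '' ↑fccSlots)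
    {sF : ℝ} (hsF : 0 ≤ sF) (hrow : LocalEndRowA ver sF ⟨Fr, inPlaneRoots Fr 1⟩ ⟨G₂, inPlaneRoots G₂ (-1)⟩)
    (X P₁ P₂ : Finset E3) (R₀ h ρ : ℝ) (hR₀ : 5 ≤ R₀) (hh : 0 ≤ h) (hρ : R₀ + 2 ≤ ρ)
    (hX : ∀ p ∈ X, ∀ q ∈ X, p ≠ q → 1 ≤ dist p q) (hP₁X : P₁ ⊆ X) (hP₂X : P₂ ⊆ X)
    (hcell : ∀ p ∈ X, -(2 * R₀) ≤ p 2 ∧ p 2 ≤ h + 2 * R₀ ∧ p 0 ^ 2 + p 1 ^ 2 ≤ ρ ^ 2)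
    (hP₁ : ∀ p, p ∈ P₁ ↔ (p ∈ stacking L₁ s₁ σ₁ ∧ -(2 * R₀) ≤ p 2 ∧ p 2 ≤ -R₀ ∧ p 0 ^ 2 + p 1 ^ 2 ≤ ρ ^ 2))
    (hP₂ : ∀ p, p ∈ P₂ ↔ (p ∈ stacking L₂ s₂ σ₂ ∧ h + R₀ ≤ p 2 ∧ p 2 ≤ h + 2 * R₀ ∧ p 0 ^ 2 + p 1 ^ 2 ≤ ρ ^ 2))
    (Kw₁ Kw₂ : Finset ℤ) :
    ∑ k ∈ Kw₁, (if ¬ (σ₁ (k - 1) = -t ∧ σ₁ k = -t) then (1 : ℝ) else 0) *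
        (4 * (∑ r ∈ inPlaneRoots Fr 1, (Fr r) 2) / (Real.sqrt 3 * (1 - (L₁.symm (EuclideanSpace.single (2 : Fin 3) (1 : ℝ))) 2 ^ 2)) *
          Real.sqrt (max 0 ((ρ - 4) ^ 2 * (1 - (L₁.symm (EuclideanSpace.single (2 : Fin 3) (1 : ℝ))) 2 ^ 2) -
            ((k : ℝ) * Real.sqrt (2 / 3) + (L₁.symm s₁) 2 -
              (-(R₀ + 1) - 1) * (L₁.symm (EuclideanSpace.single (2 : Fin 3) (1 : ℝ))) 2) ^ 2)) -
          ((inPlaneRoots Fr 1).card : ℝ)) +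
      ∑ k ∈ Kw₂, (if ¬ (σ₂ (k - 1) = -t' ∧ σ₂ k = -t') then (1 : ℝ) else 0) *
        (4 * (∑ r ∈ inPlaneRoots G₂ (-1), -(G₂ r) 2) / (Real.sqrt 3 * (1 - (L₂.symm (EuclideanSpace.single (2 : Fin 3) (1 : ℝ))) 2 ^ 2)) *
          Real.sqrt (max 0 ((ρ - 4) ^ 2 * (1 - (L₂.symm (EuclideanSpace.single (2 : Fin 3) (1 : ℝ))) 2 ^ 2) -
            ((k : ℝ) * Real.sqrt (2 / 3) + (L₂.symm s₂) 2 -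
              (h + (R₀ + 1) + 1) * (L₂.symm (EuclideanSpace.single (2 : Fin 3) (1 : ℝ))) 2) ^ 2)) -
          ((inPlaneRoots G₂ (-1)).card : ℝ)) ≤
      sF * ∑ y ∈ X.filter (fun y => (X.filter fun q => dist y q = 1).card ≠ 12 ∧ -R₀ - 2 ≤ y 2 ∧ y 2 ≤ h + R₀ + 2),
          ((12 : ℝ) - ((X.filter fun q => dist y q = 1).card : ℝ)) +
        ((∑ r ∈ inPlaneRoots Fr 1, (X.filter fun b => -(R₀ + 1) - 1 ≤ b 2 ∧ b 2 < h + (R₀ + 1) + 1 ∧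
            (∃ μ, ⟪r, μ⟫_ℝ = Real.sqrt (2 / 3) ∧ IsTwinReading X Fr (Fr μ) b) ∧ b - Fr r ∈ X).card : ℕ) : ℝ) +
        ((∑ r ∈ inPlaneRoots G₂ (-1), (X.filter fun b => -(R₀ + 1) - 1 < b 2 ∧ b 2 ≤ h + (R₀ + 1) + 1 ∧
            (∃ μ, ⟪r, μ⟫_ℝ = Real.sqrt (2 / 3) ∧ IsTwinReading X G₂ (G₂ μ) b) ∧ b - G₂ r ∈ X).card : ℕ) : ℝ) +
        (3456 * sF + 1710720) * ρ := by
  have hflux := hexagon_twoPlate_flux_le_payers_cuts ver hg hc hσ₁ hσ₂ L₁ L₂ s₁ s₂ Fr hFr G₂ hG₂ hne₁ hne₂ hne₁' hne₂' hrow X P₁ P₂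
    R₀ h ρ hR₀ hh hρ hX hP₁X hP₂X hP₁ hP₂ Kw₁ Kw₂
  have hPAYW := widenedPayerSum_le hσ₁ hσ₂ L₁ L₂ s₁ s₂ hX hP₁X hP₂X hcell hP₁ hP₂ (by linarith) (by linarith)
  have hmono := mul_le_mul_of_nonneg_left hPAYW hsF
  -- the four rims
  have hsepX : ∀ (S : Finset E3), S ⊆ X → ∀ p ∈ S, ∀ q ∈ S, p ≠ q → 1 ≤ dist p q :=
    fun S hS p hp q hq hpq => hX p (hS hp) q (hS hq) hpq
  have hrimT : ((X.filter fun s => h + (R₀ + 1) + 1 ≤ s 2 ∧ s 2 ≤ h + (R₀ + 1) + 1 + 1 ∧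
      (ρ - 1 - 2) ^ 2 < s 0 ^ 2 + s 1 ^ 2).card : ℝ) ≤ 180 * ρ :=
    card_band_annulus₃_le _ (hsepX _ (filter_subset _ _)) (h + (R₀ + 1) + 1) ρ (by linarith)
      (fun p hp => by
        obtain ⟨hpX, h1, h2, h3⟩ := mem_filter.1 hp
        exact ⟨h1, h2, h3, (hcell p hpX).2.2⟩)
  have hrimB : ((X.filter fun s => -(R₀ + 1) - 1 - 1 ≤ s 2 ∧ s 2 < -(R₀ + 1) - 1 ∧
      (ρ - 1 - 1) ^ 2 < s 0 ^ 2 + s 1 ^ 2).card : ℝ) ≤ 144 * ρ :=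
    card_band_annulus₂_le _ (hsepX _ (filter_subset _ _)) (-(R₀ + 1) - 1 - 1) ρ (by linarith)
      (fun p hp => by
        obtain ⟨hpX, h1, h2, h3⟩ := mem_filter.1 hp
        exact ⟨h1, by linarith, h3, (hcell p hpX).2.2⟩)
  have hrim₁ : ((X.filter fun s => -(R₀ + 1) - 1 - 1 ≤ s 2 ∧ s 2 ≤ -(R₀ + 1) - 1 ∧
      (ρ - 1 - 2) ^ 2 < s 0 ^ 2 + s 1 ^ 2).card : ℝ) ≤ 180 * ρ :=
    card_band_annulus₃_le _ (hsepX _ (filter_subset _ _)) (-(R₀ + 1) - 1 - 1) ρ (by linarith)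
      (fun p hp => by
        obtain ⟨hpX, h1, h2, h3⟩ := mem_filter.1 hp
        exact ⟨h1, by linarith, h3, (hcell p hpX).2.2⟩)
  have hrim₂ : ((X.filter fun s => h + (R₀ + 1) + 1 < s 2 ∧ s 2 ≤ h + (R₀ + 1) + 1 + 1 ∧
      (ρ - 1 - 1) ^ 2 < s 0 ^ 2 + s 1 ^ 2).card : ℝ) ≤ 144 * ρ :=
    card_band_annulus₂_le _ (hsepX _ (filter_subset _ _)) (h + (R₀ + 1) + 1) ρ (by linarith)
      (fun p hp => by
        obtain ⟨hpX, h1, h2, h3⟩ := mem_filter.1 hp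
        exact ⟨h1.le, h2, h3, (hcell p hpX).2.2⟩)
  have hRT₁ : ((inPlaneRoots Fr 1).card : ℝ) ≤ 12 := by
    have : (inPlaneRoots Fr 1).card ≤ 12 := (card_le_card (filter_subset _ _)).trans (by rw [card_fccSlots])
    exact_mod_cast this
  have hRT₂ : ((inPlaneRoots G₂ (-1)).card : ℝ) ≤ 12 := by
    have : (inPlaneRoots G₂ (-1)).card ≤ 12 := (card_le_card (filter_subset _ _)).trans (by rw [card_fccSlots])
    exact_mod_cast this
  have hprod : ∀ a b c : ℝ, 0 ≤ a → a ≤ 12 → 0 ≤ b → b ≤ 180 * ρ → 0 ≤ c → c ≤ 144 * ρ → a * (220 * b + 220 * c) ≤ 855360 * ρ := by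
    intro a b c ha ha' hb hb' hc hc'
    nlinarith
  have hrims₁ := hprod _ _ _ (Nat.cast_nonneg _) hRT₁ (Nat.cast_nonneg _) hrimT (Nat.cast_nonneg _) hrimB
  have hrims₂ := hprod _ _ _ (Nat.cast_nonneg _) hRT₂ (Nat.cast_nonneg _) hrim₁ (Nat.cast_nonneg _) hrim₂
  linarith only [hflux, hmono, hrims₁, hrims₂]

end Summit.Ventures.Crystal3D.Theorems

end
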